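import Mathlib
import HarnessLib

/-!
# The Poincaré half-slope of secant-square objects and its `𝔽₂`-rank obstruction (negative lemma for K2ᵀ, rung-1 g5)

Crux `stmt-HodgeConjecture-28148` (K2ᵀ, `Theses.KleimanBFSeeds.TwistNormalisedKleimanSemiregularAnchor`), line
`Cruxes/TwistNormalisedKleimanSemiregularAnchor/Lines/chosen_anchor.lean`, stub `stub_rung_CMclass_d3 : KleimanAnchorRungCM 3`.
HONEST LABEL: a `--supports` helper (Negative/ lane); it neither proves nor refutes the rung, K2ᵀ, `WeilSixfolds`, HC_AV,
HC_CM or HC. What is KERNEL-CHECKED here is only the linear-algebra kernel (§2–§3) of the pen obstruction recorded in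
the crux memo `CENSUS-5-POINCARE-HALF-SLOPE-rung1-g5.md` (same directory of the tree); the identification of the
cohomology classes with the linear maps below is PEN (§1 of this docstring), from the cited pages.

## §1 The pen chain (what the lemmas are the shadow of)

Let `X` be a principally polarised abelian threefold, `X̂` its dual, `V = H¹(X,ℤ) ⊕ H¹(X̂,ℤ)` (rank `12`), `𝒫` the
Poincaré line bundle on `X × X̂`, `P ⊂ H^{ev}(X,ℚ)` a `K`-secant plane (`K = ℚ(√−d)`), `Ξ_P` the associated
polarisation and `Spin(V)_P` the stabiliser [Markman2025SecantWeil = arXiv:2502.03415, §2.4, §3.1]. For EVERY secant-square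
object `E = Φ(F₂ ⊠ F₁^∨)` (`ch Fᵢ ∈ P`) of rank `r ≠ 0` — in particular Markman's reflexive sheaf `Ē` of rank `8d`
and every line-bundle twist, dual, shift or `Ḡ`-descent of it —

  **(P½)** `c₁(E) = (r/2)·c₁(𝒫) + t·Ξ_P` for some `t ∈ ℚ`:

`ch(E) ∪ exp(−½c₁(𝒫))` is `Spin(V)_P`-invariant for the representation `ρ` [cite: Markman2025SecantWeil, §1.3 eq.
(ρ′), §6.1, proof of Lemma 6.2.3, Lemma 6.2.9 (1)] [cite: Markman2025SurveySecant, Prop. 9.1 and Cor. 9.2], and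
`(∧²V_ℚ)^{Spin(V)_P} = ℚ·Ξ_P` is one-dimensional [cite: Markman2025SecantWeil, Cor. 4.0.7]. The class `c₁(𝒫) = Σᵢ eᵢ ∧ fᵢ` lies in
the middle Künneth summand `H¹(X,ℤ) ⊗ H¹(X̂,ℤ)`, is primitive, and is `K`-ANTISYMMETRIC (`f^* c₁(𝒫) = −d·c₁(𝒫)`,
`f = η(√−d)`), whereas `Ξ_P ∈ ℚΘ_X ⊕ ℚΘ_X̂` is `K`-symmetric with zero middle component
[cite: Markman2025SecantWeil, §2.4 and Cor. 3.2.3]. Consequently the slope `c₁/r ≡ ½c₁(𝒫) (mod H²(X×X̂,ℤ) + ℚΞ_P)` of every such object is NEVER on the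
polarisation line: the design `R♮` of `MARKMAN-TRANSPORT-LANDHERR-rung1-g4.md` §4.3 (which needs an input with
`c₁(Ē) = rμ·h₁`) has no admissible untwisted input. Its natural repair — twist by a line bundle `M` and absorb
the rest in the fibre class `θ₆ = [Y × {p}]` of the elementary transformation, asking only
`c₁(Ē ⊗ M) − rk(Q)·θ₆ ∈ ℚ·h^♮_b` — requires `½c₁(𝒫) ∈ H²(ℤ) + ℚΞ_P + ℚθ₆`, hence, REDUCING MOD 2 (alternating
forms on `V ⊗ 𝔽₂ = 𝔽₂¹²`, i.e. linear maps `V/2V → (V/2V)^*`):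

  `c₁(𝒫) mod 2 = a·(Ξ₀ mod 2) + b·(θ₆ mod 2)`, `a, b ∈ 𝔽₂`,

where `c₁(𝒫) mod 2` is the standard symplectic form (NON-DEGENERATE, rank `12`), `Ξ₀ = Θ_X + dΘ_X̂ ≡ Θ_X (mod 2)`
for the even `d` of Markman's semiregular construction (a form PULLED BACK FROM the `6`-dimensional quotient
`H¹(X,𝔽₂)`, rank `≤ 6`), and `θ₆ = u ∧ v` is DECOMPOSABLE (rank `≤ 2`); parallel transport to the product point
preserves all three shapes. §3 below is exactly the statement that this is impossible: `12 > 6 + 2`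
(`4n > 2n + 2` for `n ≥ 2`). (For odd `d` the same conclusion holds by the explicit rank `rank(𝒫 + Θ_X + Θ_X̂ mod 2)
= 6 > 2`, checked in the memo's script; not typed here.) In the TWISTED door (trivial-determinant `μ_{8d}`-twisted
sheaves, Markman §7) the class equation of `R♮` survives with the slope parameter free — that door is not in the
tree (typed weakness W3 of the g4 memo).

## §2–§3 What is proved (elementary linear algebra over any field)

* `range_add_smul_le`, `finrank_range_add_smul_le`, `finrank_range_add_le`, `finrank_range_smul_le`,
  `finrank_range_sum_le`: `rk(a·s + b·t) ≤ rk s + rk t` and its iterates.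
* `finrank_range_comp_le_of_le`: a map factoring through a space of dimension `≤ m` has rank `≤ m`.
* `finrank_range_smulRight_le_one`, `finrank_range_wedge_le_two`: `x ↦ φ(x)·v` has rank `≤ 1`, the
  "decomposable" map `x ↦ φ(x)·v − ψ(x)·u` has rank `≤ 2`.
* `finrank_range_equiv`: an isomorphism onto a space of dimension `N` has rank `N`.
* `not_eq_smul_add_smul_of_ranks` (abstract obstruction) and **`poincare_mod_two_ne_polarisation_add_fibre`**
  (the `4n > 2n + 2` instance): a full-rank map `V ≃ W`, `dim W = 4n`, `n ≥ 2`, is not `a·s + b·t` with `s`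
  factoring through a space of dimension `≤ 2n` and `t` decomposable; `…_add_fibres`: nor `a·s + Σ_{i<k} bᵢ·tᵢ`
  with `k < n` decomposable `tᵢ`.
* `fromBlocks_zero_one_one_zero_mul_self`: the Gram matrix `[[0, 1], [1, 0]]` of the standard symplectic form
  squares to `1` over every ring (its reduction mod `2` is invertible: the full-rank hypothesis for `c₁(𝒫) mod 2`).

References: [Markman2025SecantWeil] E. Markman, Cycles on abelian 2n-folds of Weil type from secant sheaves on
abelian n-folds, arXiv:2502.03415, §1.3, §2.4, Cor. 3.2.3, Lemma 3.1.1, Cor. 4.0.7, Lemma 6.2.3, Remark 6.2.4,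
Lemma 6.2.5, Lemma 6.2.9, Prop. 9.2.2, §9.3; [Markman2025SurveySecant] E. Markman, Secant sheaves and Weil classes on
abelian varieties, arXiv:2509.23403, Prop. 9.1, Cor. 9.2, §3 (twisted sheaves); [BirkenhakeLange2004] Ch. Birkenhake,
H. Lange, Complex Abelian Varieties (2nd ed.), §2.5 (the Poincaré bundle and `c₁(𝒫)`), §1.1.
-/

-- every declaration of this problem lives in `Summit.HodgeConjecture.HodgeConjecture.…` (summit = sub-problem)
set_option linter.dupNamespace false

noncomputable section

namespace Summit.HodgeConjecture.HodgeConjecture.Theorems.TwistNormalisedKleimanSemiregularAnchor.Negative.PoincareParity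

open Module

section Ranks

variable {K : Type*} [Field K] {V W U : Type*} [AddCommGroup V] [Module K V] [AddCommGroup W] [Module K W]
  [AddCommGroup U] [Module K U]

/-- **§2 (subadditivity, range form).** `range(a·s + b·t) ⊆ range s + range t`. [folklore] -/
theorem range_add_smul_le (s t : V →ₗ[K] W) (a b : K) :
    LinearMap.range (a • s + b • t) ≤ LinearMap.range s ⊔ LinearMap.range t := by
  rintro _ ⟨x, rfl⟩
  simp only [LinearMap.add_apply, LinearMap.smul_apply]
  exact Submodule.add_mem _
    (Submodule.mem_sup_left (Submodule.smul_mem _ a (LinearMap.mem_range_self s x)))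
    (Submodule.mem_sup_right (Submodule.smul_mem _ b (LinearMap.mem_range_self t x)))

/-- **§2 (subadditivity of ranks).** `rk(a·s + b·t) ≤ rk s + rk t` (ranks = dimensions of ranges).
[folklore] -/
theorem finrank_range_add_smul_le [FiniteDimensional K W] (s t : V →ₗ[K] W) (a b : K) :
    finrank K (LinearMap.range (a • s + b • t)) ≤
      finrank K (LinearMap.range s) + finrank K (LinearMap.range t) :=
  (Submodule.finrank_mono (range_add_smul_le s t a b)).trans
    (Submodule.finrank_add_le_finrank_add_finrank _ _)

/-- `rk(s + t) ≤ rk s + rk t`. [folklore] -/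
theorem finrank_range_add_le [FiniteDimensional K W] (s t : V →ₗ[K] W) :
    finrank K (LinearMap.range (s + t)) ≤ finrank K (LinearMap.range s) + finrank K (LinearMap.range t) := by
  have h := finrank_range_add_smul_le s t (1 : K) (1 : K)
  rwa [one_smul, one_smul] at h

/-- `rk(a·s) ≤ rk s`. [folklore] -/
theorem finrank_range_smul_le [FiniteDimensional K W] (s : V →ₗ[K] W) (a : K) :
    finrank K (LinearMap.range (a • s)) ≤ finrank K (LinearMap.range s) := by
  refine Submodule.finrank_mono ?_
  rintro _ ⟨x, rfl⟩
  exact Submodule.smul_mem _ _ (LinearMap.mem_range_self _ x)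

/-- A sum of `m` maps of rank `≤ c` has rank `≤ c·m`. [folklore] -/
theorem finrank_range_sum_le [FiniteDimensional K W] {m c : ℕ} (f : Fin m → V →ₗ[K] W)
    (hf : ∀ i, finrank K (LinearMap.range (f i)) ≤ c) :
    finrank K (LinearMap.range (∑ i, f i)) ≤ c * m := by
  induction m with
  | zero => simp
  | succ m ih =>
    rw [Fin.sum_univ_castSucc]
    have h' := ih (fun i => f (Fin.castSucc i)) (fun i => hf _)
    have step := finrank_range_add_le (∑ i : Fin m, f (Fin.castSucc i)) (f (Fin.last m))
    have hl := hf (Fin.last m)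
    have : c * (m + 1) = c * m + c := by ring
    omega

/-- **§2 (rank of a map factoring through a small space).** If `s = j ∘ g` through a space `U` of dimension
`≤ m`, then `rk s ≤ m` — the shape of `Θ_X mod 2`, a form pulled back from the `2n`-dimensional `H¹(X, 𝔽₂)`.
[folklore] -/
theorem finrank_range_comp_le_of_le [FiniteDimensional K U] {m : ℕ} (hU : finrank K U ≤ m) (g : V →ₗ[K] U)
    (j : U →ₗ[K] W) : finrank K (LinearMap.range (j ∘ₗ g)) ≤ m :=
  calc finrank K (LinearMap.range (j ∘ₗ g)) ≤ finrank K (LinearMap.range j) :=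
        Submodule.finrank_mono (LinearMap.range_comp_le_range g j)
    _ ≤ finrank K U := LinearMap.finrank_range_le j
    _ ≤ m := hU

/-- A rank-one shape: `x ↦ φ(x)·v` has range inside the line `K·v`, so rank `≤ 1`. [folklore] -/
theorem finrank_range_smulRight_le_one (φ : Module.Dual K V) (v : W) :
    finrank K (LinearMap.range (φ.smulRight v)) ≤ 1 := by
  have hle : LinearMap.range (φ.smulRight v) ≤ Submodule.span K ({v} : Set W) := by
    rintro _ ⟨x, rfl⟩
    rw [LinearMap.smulRight_apply]
    exact Submodule.smul_mem _ _ (Submodule.subset_span rfl)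
  calc finrank K (LinearMap.range (φ.smulRight v)) ≤ finrank K (Submodule.span K ({v} : Set W)) :=
        Submodule.finrank_mono hle
    _ ≤ ({v} : Set W).toFinset.card := finrank_span_le_card ({v} : Set W)
    _ ≤ 1 := by simp

/-- **§2 (decomposable maps have rank ≤ 2).** The map `x ↦ φ(x)·v − ψ(x)·u` — the shape of a decomposable
alternating form `u ∧ v` read as a map `V → V^*`, e.g. the fibre class `θ₆ = [Y × {p}] mod 2` — has rank `≤ 2`.
[folklore] -/
theorem finrank_range_wedge_le_two [FiniteDimensional K W] (φ ψ : Module.Dual K V) (u v : W) :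
    finrank K (LinearMap.range (φ.smulRight v - ψ.smulRight u)) ≤ 2 := by
  have h := finrank_range_add_smul_le (φ.smulRight v) (ψ.smulRight u) (1 : K) (-1 : K)
  rw [one_smul, neg_one_smul, ← sub_eq_add_neg] at h
  have h1 := finrank_range_smulRight_le_one (W := W) φ v
  have h2 := finrank_range_smulRight_le_one (W := W) ψ u
  omega

/-- **§2 (full rank).** An isomorphism onto `W` has rank `dim W` — the shape of the NON-DEGENERATE form
`c₁(𝒫) mod 2` (the standard symplectic form on `V ⊗ 𝔽₂`). [folklore] -/
theorem finrank_range_equiv (p : V ≃ₗ[K] W) :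
    finrank K (LinearMap.range (p : V →ₗ[K] W)) = finrank K W := by
  rw [LinearEquiv.range, finrank_top]

/-- **§3 (abstract obstruction).** If `rk s + rk t < rk p` then `p ≠ a·s + b·t` for all scalars `a, b`.
[folklore] -/
theorem not_eq_smul_add_smul_of_ranks [FiniteDimensional K W] {p s t : V →ₗ[K] W}
    (h : finrank K (LinearMap.range s) + finrank K (LinearMap.range t) < finrank K (LinearMap.range p))
    (a b : K) : p ≠ a • s + b • t := by
  rintro rfl
  have h' := finrank_range_add_smul_le s t a b
  omega

/-- **§3 THE `𝔽₂`-RANK OBSTRUCTION (`4n > 2n + 2`).** Let `dim W = 4n` with `n ≥ 2`, `p : V ≃ W` (full rank: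
`c₁(𝒫) mod 2`), `s = j ∘ g` factoring through a space of dimension `≤ 2n` (`Ξ₀ ≡ Θ_X mod 2`, `d` even) and
`t = φ(·)·v − ψ(·)·u` decomposable (`θ₆ mod 2`). Then `p ≠ a·s + b·t` for all `a, b`. With `K = 𝔽₂`, `n = 3` this is
the degree-one death of the repaired design `R♮`: `½c₁(𝒫) ∉ H²(ℤ) + ℚΞ_P + ℚθ₆` (§1).
[cite: Markman2025SecantWeil, Lemma 6.2.9 (1), Lemma 6.2.3, Cor. 4.0.7 and §2.4] -/
theorem poincare_mod_two_ne_polarisation_add_fibre [FiniteDimensional K W] [FiniteDimensional K U] {n : ℕ}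
    (hn : 2 ≤ n) (hW : finrank K W = 4 * n) (p : V ≃ₗ[K] W) (hU : finrank K U ≤ 2 * n) (g : V →ₗ[K] U)
    (j : U →ₗ[K] W) (φ ψ : Module.Dual K V) (u v : W) (a b : K) :
    (p : V →ₗ[K] W) ≠ a • (j ∘ₗ g) + b • (φ.smulRight v - ψ.smulRight u) := by
  apply not_eq_smul_add_smul_of_ranks
  have h1 := finrank_range_comp_le_of_le hU g j
  have h2 := finrank_range_wedge_le_two (W := W) φ ψ u v
  rw [finrank_range_equiv, hW]
  omega

/-- The same with the two summands in the other order (`p ≠ a·t + b·s`). [folklore] -/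
theorem poincare_mod_two_ne_fibre_add_polarisation [FiniteDimensional K W] [FiniteDimensional K U] {n : ℕ}
    (hn : 2 ≤ n) (hW : finrank K W = 4 * n) (p : V ≃ₗ[K] W) (hU : finrank K U ≤ 2 * n) (g : V →ₗ[K] U)
    (j : U →ₗ[K] W) (φ ψ : Module.Dual K V) (u v : W) (a b : K) :
    (p : V →ₗ[K] W) ≠ a • (φ.smulRight v - ψ.smulRight u) + b • (j ∘ₗ g) := by
  rw [add_comm]
  exact poincare_mod_two_ne_polarisation_add_fibre hn hW p hU g j φ ψ u v b a

/-- **More divisors.** The same count with a polarisation-type summand and `k` decomposable summands: if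
`k < n` (so `2n + 2k < 4n`) then `p` is not `a·s + Σᵢ bᵢ·tᵢ` — elementary transformations along fewer than `n`
fibre-type divisors cannot absorb the Poincaré half either (pen reading; only the rank count is typed).
[folklore] -/
theorem poincare_mod_two_ne_polarisation_add_fibres [FiniteDimensional K W] [FiniteDimensional K U] {n k : ℕ}
    (hk : k < n) (hW : finrank K W = 4 * n) (p : V ≃ₗ[K] W) (hU : finrank K U ≤ 2 * n) (g : V →ₗ[K] U)
    (j : U →ₗ[K] W) (φ ψ : Fin k → Module.Dual K V) (u v : Fin k → W) (a : K) (b : Fin k → K) :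
    (p : V →ₗ[K] W) ≠ a • (j ∘ₗ g) + ∑ i, b i • ((φ i).smulRight (v i) - (ψ i).smulRight (u i)) := by
  intro h
  have hT : finrank K (LinearMap.range (∑ i, b i • ((φ i).smulRight (v i) - (ψ i).smulRight (u i)))) ≤
      2 * k :=
    finrank_range_sum_le _ fun i =>
      (finrank_range_smul_le _ _).trans (finrank_range_wedge_le_two _ _ _ _)
  have hS : finrank K (LinearMap.range (a • (j ∘ₗ g))) ≤ 2 * n :=
    (finrank_range_smul_le _ _).trans (finrank_range_comp_le_of_le hU g j)
  have htot := finrank_range_add_le (a • (j ∘ₗ g))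
    (∑ i, b i • ((φ i).smulRight (v i) - (ψ i).smulRight (u i)))
  have hp := finrank_range_equiv p
  rw [h, hW] at hp
  omega

end Ranks

section Gram

/-- **The standard symplectic Gram matrix squares to the identity**: `[[0, 1], [1, 0]]² = 1` in block form over
every ring — so its reduction modulo `2` is invertible and `c₁(𝒫) mod 2 = Σᵢ eᵢ ∧ fᵢ` is a non-degenerate form on
`V ⊗ 𝔽₂` (the full-rank hypothesis `p : V ≃ W` of §3). [cite: BirkenhakeLange2004, §2.5 (c₁ of the Poincaré bundle)] -/
theorem fromBlocks_zero_one_one_zero_mul_self {R : Type*} [CommRing R] {m : Type*} [Fintype m] [DecidableEq m] :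
    Matrix.fromBlocks (0 : Matrix m m R) (1 : Matrix m m R) (1 : Matrix m m R) (0 : Matrix m m R) *
        Matrix.fromBlocks (0 : Matrix m m R) (1 : Matrix m m R) (1 : Matrix m m R) (0 : Matrix m m R) = 1 := by
  rw [Matrix.fromBlocks_multiply]
  simp

/-- Hence the block matrix `[[0, 1], [1, 0]]` is a unit (its own inverse). [folklore] -/
theorem isUnit_fromBlocks_zero_one_one_zero {R : Type*} [CommRing R] {m : Type*} [Fintype m] [DecidableEq m] :
    IsUnit (Matrix.fromBlocks (0 : Matrix m m R) (1 : Matrix m m R) (1 : Matrix m m R) (0 : Matrix m m R)) :=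
  ⟨⟨_, _, fromBlocks_zero_one_one_zero_mul_self, fromBlocks_zero_one_one_zero_mul_self⟩, rfl⟩

end Gram

end Summit.HodgeConjecture.HodgeConjecture.Theorems.TwistNormalisedKleimanSemiregularAnchor.Negative.PoincareParity

end
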